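import Literature.InformationTheory.QuantumCodes.UnionFindDecoderRadius
import HarnessLib

/-!
# Erasures only: Algorithm 1 reduces to the peeling decoder and succeeds iff the erasure carries no logical

Topic `Literature/InformationTheory/QuantumCodes` (qec cell, LIT-2 lane «union-find / peeling», PARTITION v2.48 D50.L7).
PROVED, no named fact, no sorry.

Delfosse–Zémor 2020 (PRR 2:033042, arXiv:1703.01517), Lemma 1: for an erasure `ℰ` and a measured syndrome `σ`, "any
coset `P̃·S` of a Pauli error `P̃ ⊂ ℰ` of syndrome `σ` is a most likely coset" (all consistent cosets are
equiprobable), whence Theorem 1: the peeling decoder — return ANY error inside the erasure with the right syndrome,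
found in linear time on a spanning forest — is a maximum-likelihood decoder over the quantum erasure channel.
Delfosse–Nickerson 2021 Algorithm 1 starts from the erasure and, when the error lies inside it, never grows
(`final_eq_initial_of_supp_subset`: every cluster of the erasure is even), so its valid outputs are exactly the
peeling outputs (`isOutput_iff_of_supp_subset`). The deterministic content of DZ20's optimality, for the `L × L`
toric code and EVERY peeling choice:

* `DelfosseZemor2020_theorem1_toric` — if the erasure `R` supports no non-trivial cycle, then for every error `e`
  inside `R`, every valid output `C` closes `e` to a boundary (success for every coset representative);
* `exists_isOutput_not_mem_boundaries` — conversely, if `R` supports a non-trivial cycle `z`, then already for the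
  error `e = 0` the chain `z` is a valid output and fails: no decoder of the erasure can do better than a coin flip
  there (the two cosets are equiprobable, DZ20 Lemma 1), and Algorithm 1 with an unlucky peeling choice fails.

## References
[cite: DelfosseZemor2020, Lemma 1 and Theorem 1 (arXiv:1703.01517 p. 3–4)]
[cite: DelfosseNickerson2021, §2 Algorithm 1 (steps 1–2, 8), §3 proof of Thm 1 ("For the case of erasures the proof is straightforward since the erasure decoder can be called immediately")]
-/

noncomputable section

namespace Literature.InformationTheory.QuantumCodes

namespace ToricCode

namespace UnionFind

open Finset

variable {L : ℕ} [NeZero L]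

/-- **An error inside the erasure leaves every initial cluster even** (each error link is erased, hence full, hence
has both ends in one cluster). [cite: DelfosseNickerson2021, §3 proof of Thm 1 ("For the case of erasures … the erasure decoder can be called immediately")] -/
theorem charge_initial_ne_one_of_supp_subset {e : Chain L} {R : Finset (Edge L)} (he : ∀ ℓ, e ℓ ≠ 0 → ℓ ∈ R)
    (v : Vertex L) : charge (syn L e) (initial R) v ≠ 1 := by
  intro h1
  obtain ⟨ℓ, heℓ, hiff⟩ := exists_errLink_of_charge_eq_one h1
  exact hiff (tail_mem_comp_iff_head_mem_comp (isFull_initial_iff.2 (he ℓ heℓ)) v)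

/-- **No growth**: with the error inside the erasure, Algorithm 1's final state is the erasure itself.
[cite: DelfosseNickerson2021, §2 Algorithm 1 (the while loop is not entered), §3 proof of Thm 1] -/
theorem final_eq_initial_of_supp_subset {e : Chain L} {R : Finset (Edge L)} (he : ∀ ℓ, e ℓ ≠ 0 → ℓ ∈ R) :
    final (syn L e) R = initial R := by
  have h0 : step (syn L e) (state (syn L e) R 0) = state (syn L e) R 0 := by
    rw [state_zero]
    exact step_eq_self_of_forall (charge_initial_ne_one_of_supp_subset he)
  rw [final, state_eq_of_step_eq h0 (Nat.zero_le _), state_zero]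

/-- **The valid outputs are the peeling outputs**: chains inside the erasure with the observed syndrome.
[cite: DelfosseZemor2020, §2 (Algorithm 1: an error P̃ ⊂ ℰ of syndrome σ)] [cite: DelfosseNickerson2021, §2 Algorithm 1 (step 8)] -/
theorem isOutput_iff_of_supp_subset {e : Chain L} {R : Finset (Edge L)} (he : ∀ ℓ, e ℓ ≠ 0 → ℓ ∈ R)
    {C : Chain L} : IsOutput (syn L e) R C ↔ (∀ ℓ, C ℓ ≠ 0 → ℓ ∈ R) ∧ syn L C = syn L e := by
  unfold IsOutput
  rw [final_eq_initial_of_supp_subset he]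
  simp only [isFull_initial_iff]

/-- **Delfosse–Zémor 2020, Theorem 1 (deterministic content), toric code.** If the erasure `R` supports no
non-trivial cycle, then for EVERY error `e` inside `R` and EVERY valid output `C` (any peeling choice / any coset
representative inside the erasure), `e + C` is a boundary: the peeling decoder, and Algorithm 1 which reduces to
it, succeeds whenever success is possible. [cite: DelfosseZemor2020, Lemma 1 and Theorem 1] -/
theorem DelfosseZemor2020_theorem1_toric {R : Finset (Edge L)}
    (hR : ∀ z ∈ cycles L, (∀ ℓ, z ℓ ≠ 0 → ℓ ∈ R) → z ∈ boundaries L) {e : Chain L}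
    (he : ∀ ℓ, e ℓ ≠ 0 → ℓ ∈ R) {C : Chain L} (hC : IsOutput (syn L e) R C) : e + C ∈ boundaries L := by
  refine hR _ hC.add_mem_cycles fun ℓ hℓ => ?_
  obtain ⟨hCR, -⟩ := (isOutput_iff_of_supp_subset he).1 hC
  by_cases heℓ : e ℓ = 0
  · have hCℓ : C ℓ ≠ 0 := by simpa [Pi.add_apply, heℓ] using hℓ
    exact hCR ℓ hCℓ
  · exact he ℓ heℓ

/-- **Converse (the bound is where ML itself fails).** If the erasure supports a non-trivial cycle `z`, then already
for the error `e = 0` the chain `z` is a valid output of Algorithm 1 (a legitimate peeling answer) and it fails: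
`0 + z ∉ boundaries`. (DZ20 Lemma 1: the two cosets are equiprobable, so no decoder beats a coin flip here.)
[cite: DelfosseZemor2020, Lemma 1] [cite: DennisEtAl2002, §4.3 (failure iff homologically non-trivial)] -/
theorem exists_isOutput_not_mem_boundaries {R : Finset (Edge L)} {z : Chain L} (hz : z ∈ cycles L)
    (hzR : ∀ ℓ, z ℓ ≠ 0 → ℓ ∈ R) (hnb : z ∉ boundaries L) :
    IsOutput (syn L (0 : Chain L)) R z ∧ (0 : Chain L) + z ∉ boundaries L := by
  have h0 : ∀ ℓ, (0 : Chain L) ℓ ≠ 0 → ℓ ∈ R := fun ℓ h => absurd rfl h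
  refine ⟨(isOutput_iff_of_supp_subset h0).2 ⟨hzR, ?_⟩, by rwa [zero_add]⟩
  have hsyn0 : syn L (0 : Chain L) = 0 := by unfold syn; exact Matrix.mulVec_zero _
  rw [hsyn0]
  exact hz

/-- **Hence, on erasures, the Union-Find decoder is optimal**: `ufDecoder R` corrects every error inside a
logical-free erasure. [cite: DelfosseZemor2020, Theorem 1] [cite: DelfosseNickerson2021, §3 Thm 1 (s = 0)] -/
theorem ufDecoder_corrects_of_supp_subset {R : Finset (Edge L)}
    (hR : ∀ z ∈ cycles L, (∀ ℓ, z ℓ ≠ 0 → ℓ ∈ R) → z ∈ boundaries L) {e : Chain L}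
    (he : ∀ ℓ, e ℓ ≠ 0 → ℓ ∈ R) : (ufDecoder R).Corrects (syn L) (boundaries L) e := by
  rw [ufDecoder_corrects_iff, add_comm]
  exact DelfosseZemor2020_theorem1_toric hR he (isOutput_ufDecoder R e)

end UnionFind

end ToricCode

end Literature.InformationTheory.QuantumCodes
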